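import Summits.CriticalPhenomena.PercolationContinuityZ3.Theorems.Transplant.FKDoubleFanRigid
import HarnessLib

/-!
# Double fans `K₂ ∨ P_{m+1}`: the TRANSFER FORMULA `Z_w = val_q(Z_m)` (affine interpolation)

Support file (`--supports stmt-CriticalPhenomena-4575`), FK sub-lane `prim-bschramm-fk-3` (gen 20); builds on p205010 (kernel theorem, internal
audit signed; external expert review pending).  No named facts, no sorries; standard axioms.  Memo `bschramm/prim-bschramm-fk-3/DOUBLE-FAN.md` §8.
Layer 2 of the measure-level bridge for double fans: for two distinct apices `a, b`, rim vertices `c 0, …, c m` (pairwise distinct, not apices)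
exhausting `V` (`card V = m + 3`) and a weight vector `w` supported on the double-fan pairs `dfPairs a b c m` (axis, spokes, rim edges),
**`rcPartitionFunctionW_eq_transferDF`**: `Z_w = transferDF q w a b c m` — the random-cluster partition function is the `q^{|π|}`-valuation of the
transfer word of `…DoubleFanWord`.  Proof by rigid interpolation (`FK.eq_of_affine_of_rigid`): both sides are affine in every pair parameter
(`transferDF_affine`: each pair is read by exactly one letter or rim step of the word, which is affine in it, everything downstream being linear —
`AffC.rimStep_right`, `affC_rimStep`), and they agree at rigid weights (`rcPartitionFunctionW_eq_transferDF_rigid`, `…DoubleFanRigid`).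
[cite: Grimmett2006, §1.4 eq. (1.20) (p. 15)] [folklore]
-/

noncomputable section

namespace Summit.CriticalPhenomena.PercolationContinuityZ3.Theorems

namespace FK

namespace ThreeApex

open Literature.Probability.LatticeModels Literature.Probability.Percolation
open scoped Classical

/-! ### Affinity tools for the rim step -/

/-- The rim step is linear in the vector. [folklore] -/
theorem AffC.rimStep_right (q r : ℝ) {t : ℝ} {Zt Z0 Z1 : V5} (h : AffC t Zt Z0 Z1) :
    AffC t (rimStep q r Zt) (rimStep q r Z0) (rimStep q r Z1) := by
  obtain ⟨h0, h1, h2, h3, h4⟩ := h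
  refine ⟨?_, ?_, ?_, ?_, ?_⟩ <;> simp only [rimStep, h0, h1, h2, h3, h4] <;> ring

/-- The rim step is affine in its probability. [folklore] -/
theorem affC_rimStep (q t : ℝ) (Z : V5) : AffC t (rimStep q t Z) (rimStep q 0 Z) (rimStep q 1 Z) := by
  refine ⟨?_, ?_, ?_, ?_, ?_⟩ <;> simp only [rimStep] <;> ring

/-- A constant triple is an affine triple. [folklore] -/
theorem affC_const (t : ℝ) (Z : V5) : AffC t Z Z Z := by
  refine ⟨?_, ?_, ?_, ?_, ?_⟩ <;> ring

/-- `conv (edgeAC t)` is affine in `t`. [folklore] -/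
theorem affC_conv_edgeAC (t : ℝ) (Z : V5) : AffC t (conv (edgeAC t) Z) (conv (edgeAC 0) Z) (conv (edgeAC 1) Z) :=
  affC_edgeAC_mul t Z

/-- `conv (edgeBC t)` is affine in `t`. [folklore] -/
theorem affC_conv_edgeBC (t : ℝ) (Z : V5) : AffC t (conv (edgeBC t) Z) (conv (edgeBC 0) Z) (conv (edgeBC 1) Z) :=
  affC_edgeBC_mul t Z

/-- `conv (edgeAB t)` is affine in `t`. [folklore] -/
theorem affC_conv_edgeAB (t : ℝ) (Z : V5) : AffC t (conv (edgeAB t) Z) (conv (edgeAB 0) Z) (conv (edgeAB 1) Z) :=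
  affC_edgeAB_mul t Z

variable {V : Type*} [Fintype V]

omit [Fintype V] in
/-- Reading an unchanged coordinate. [folklore] -/
theorem wR_update_of_ne (w : Sym2 V → unitInterval) {e e' : Sym2 V} (h : e' ≠ e) (t : unitInterval) :
    wR (Function.update w e t) e' = wR w e' := by
  simp only [wR, Function.update_of_ne h]

omit [Fintype V] in
/-- Reading the updated coordinate. [folklore] -/
theorem wR_update_self (w : Sym2 V → unitInterval) (e : Sym2 V) (t : unitInterval) : wR (Function.update w e t) e = (t : ℝ) := by
  simp only [wR, Function.update_self]

section Setting

variable {a b : V} {c : ℕ → V} {m : ℕ}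
variable (hab : a ≠ b) (hinj : ∀ j k, j ≤ m → k ≤ m → c j = c k → j = k) (hca : ∀ j, j ≤ m → c j ≠ a) (hcb : ∀ j, j ≤ m → c j ≠ b)
include hab hinj hca hcb

/-! ### Which block reads which pair -/

/-- The pairs read by block `k` of the word: the two spokes of `c k`, and the axis (`k = 0`) or the rim edge into `c k` (`k ≥ 1`). [folklore] -/
def ReadsAt (a b : V) (c : ℕ → V) (k : ℕ) (e : Sym2 V) : Prop :=
  e = s(a, c k) ∨ e = s(b, c k) ∨ (k = 0 ∧ e = s(a, b)) ∨ (∃ i, k = i + 1 ∧ e = s(c i, c (i + 1)))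

omit [Fintype V] hab hinj hca hcb in
/-- If block `0` does not read `e`, updating `e` does not change `Z_0`. [folklore] -/
theorem zDF_zero_update (q : ℝ) (w : Sym2 V → unitInterval) {e : Sym2 V} (h : ¬ ReadsAt a b c 0 e) (t : unitInterval) :
    zDF q (Function.update w e t) a b c 0 = zDF q w a b c 0 := by
  have h1 : e ≠ s(a, c 0) := fun h' => h (Or.inl h')
  have h2 : e ≠ s(b, c 0) := fun h' => h (Or.inr (Or.inl h'))
  have h3 : e ≠ s(a, b) := fun h' => h (Or.inr (Or.inr (Or.inl ⟨rfl, h'⟩)))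
  simp only [zDF, wR_update_of_ne w (Ne.symm h1), wR_update_of_ne w (Ne.symm h2), wR_update_of_ne w (Ne.symm h3)]

omit [Fintype V] hab hinj hca hcb in
/-- If block `j+1` does not read `e`, the update passes through block `j+1`. [folklore] -/
theorem zDF_succ_update (q : ℝ) (w : Sym2 V → unitInterval) {e : Sym2 V} {j : ℕ} (h : ¬ ReadsAt a b c (j + 1) e) (t : unitInterval) (Z : V5)
    (hZ : zDF q (Function.update w e t) a b c j = Z) :
    zDF q (Function.update w e t) a b c (j + 1) =
      conv (edgeAC (wR w s(a, c (j + 1)))) (conv (edgeBC (wR w s(b, c (j + 1)))) (rimStep q (wR w s(c j, c (j + 1))) Z)) := by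
  have h1 : e ≠ s(a, c (j + 1)) := fun h' => h (Or.inl h')
  have h2 : e ≠ s(b, c (j + 1)) := fun h' => h (Or.inr (Or.inl h'))
  have h4 : e ≠ s(c j, c (j + 1)) := fun h' => h (Or.inr (Or.inr (Or.inr ⟨j, rfl, h'⟩)))
  simp only [zDF, hZ, wR_update_of_ne w (Ne.symm h1), wR_update_of_ne w (Ne.symm h2), wR_update_of_ne w (Ne.symm h4)]

omit [Fintype V] hab hinj hca hcb in
/-- **Before the reading block nothing changes.** [folklore] -/
theorem zDF_update_eq_of_not_reads (q : ℝ) (w : Sym2 V → unitInterval) {e : Sym2 V} (t : unitInterval) :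
    ∀ j, (∀ k, k ≤ j → ¬ ReadsAt a b c k e) → zDF q (Function.update w e t) a b c j = zDF q w a b c j := by
  intro j
  induction j with
  | zero => intro h; exact zDF_zero_update q w (h 0 le_rfl) t
  | succ j ih =>
    intro h
    rw [zDF_succ_update q w (h (j + 1) le_rfl) t _ (ih fun k hk => h k (by omega))]
    rfl

omit [Fintype V] hab hinj hca hcb in
/-- **After the reading block the three words form an affine triple** (the word is linear downstream). [folklore] -/
theorem affC_zDF_of_le (q : ℝ) (w : Sym2 V → unitInterval) {e : Sym2 V} (t : unitInterval) {j₀ : ℕ}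
    (h0 : AffC (t : ℝ) (zDF q (Function.update w e t) a b c j₀) (zDF q (Function.update w e 0) a b c j₀) (zDF q (Function.update w e 1) a b c j₀))
    (hlater : ∀ k, j₀ < k → k ≤ m → ¬ ReadsAt a b c k e) :
    ∀ d : ℕ, j₀ + d ≤ m → AffC (t : ℝ) (zDF q (Function.update w e t) a b c (j₀ + d)) (zDF q (Function.update w e 0) a b c (j₀ + d))
      (zDF q (Function.update w e 1) a b c (j₀ + d)) := by
  intro d
  induction d with
  | zero => intro _; simpa using h0
  | succ d ih =>
    intro hd
    rw [show j₀ + (d + 1) = (j₀ + d) + 1 by omega]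
    have hr := hlater (j₀ + d + 1) (by omega) (by omega)
    rw [zDF_succ_update q w hr t _ rfl, zDF_succ_update q w hr 0 _ rfl, zDF_succ_update q w hr 1 _ rfl]
    exact (((ih (by omega)).rimStep_right q _).conv_right _).conv_right _

/-! ### Pair bookkeeping -/

omit [Fintype V] hab hinj hca hcb in
/-- A spoke of `a` is not the axis. [folklore] -/
theorem spokeA_ne_axis (hab : a ≠ b) (hcb : ∀ j, j ≤ m → c j ≠ b) {j : ℕ} (hj : j ≤ m) : s(a, c j) ≠ s(a, b) := by
  intro h
  rcases Sym2.eq_iff.1 h with ⟨_, h2⟩ | ⟨h1, _⟩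
  · exact hcb j hj h2
  · exact hab h1

omit [Fintype V] hab hinj hca hcb in
/-- A spoke of `b` is not the axis. [folklore] -/
theorem spokeB_ne_axis (hab : a ≠ b) (hca : ∀ j, j ≤ m → c j ≠ a) {j : ℕ} (hj : j ≤ m) : s(b, c j) ≠ s(a, b) := by
  intro h
  rcases Sym2.eq_iff.1 h with ⟨h1, _⟩ | ⟨_, h2⟩
  · exact hab h1.symm
  · exact hca j hj h2

omit [Fintype V] hab hinj hca hcb in
/-- A rim edge is not the axis. [folklore] -/
theorem rim_ne_axis (hca : ∀ j, j ≤ m → c j ≠ a) {i : ℕ} (hi : i + 1 ≤ m) : s(c i, c (i + 1)) ≠ s(a, b) := by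
  intro h
  rcases Sym2.eq_iff.1 h with ⟨h1, _⟩ | ⟨_, h2⟩
  · exact hca i (by omega) h1
  · exact hca (i + 1) hi h2

omit [Fintype V] hab hinj hca hcb in
/-- Spokes of `a` at different rim vertices differ. [folklore] -/
theorem spokeA_ne_spokeA (hinj : ∀ j k, j ≤ m → k ≤ m → c j = c k → j = k) {j k : ℕ} (hj : j ≤ m) (hk : k ≤ m) (hjk : j ≠ k) :
    s(a, c j) ≠ s(a, c k) := by
  intro h
  rcases Sym2.eq_iff.1 h with ⟨_, h2⟩ | ⟨h1, h2⟩
  · exact hjk (hinj j k hj hk h2)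
  · exact hjk (hinj j k hj hk (h2.trans h1))

omit [Fintype V] hab hinj hca hcb in
/-- A spoke of `a` is not a spoke of `b`. [folklore] -/
theorem spokeA_ne_spokeB (hab : a ≠ b) (hca : ∀ j, j ≤ m → c j ≠ a) {j k : ℕ} (hk : k ≤ m) : s(a, c j) ≠ s(b, c k) := by
  intro h
  rcases Sym2.eq_iff.1 h with ⟨h1, _⟩ | ⟨h1, _⟩
  · exact hab h1
  · exact hca k hk h1.symm

omit [Fintype V] hab hinj hca hcb in
/-- A spoke of `a` is not a rim edge. [folklore] -/
theorem spokeA_ne_rim (hca : ∀ j, j ≤ m → c j ≠ a) {j i : ℕ} (hi : i + 1 ≤ m) : s(a, c j) ≠ s(c i, c (i + 1)) := by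
  intro h
  rcases Sym2.eq_iff.1 h with ⟨h1, _⟩ | ⟨h1, _⟩
  · exact hca i (by omega) h1.symm
  · exact hca (i + 1) hi h1.symm

omit [Fintype V] hab hinj hca hcb in
/-- Spokes of `b` at different rim vertices differ. [folklore] -/
theorem spokeB_ne_spokeB (hinj : ∀ j k, j ≤ m → k ≤ m → c j = c k → j = k) {j k : ℕ} (hj : j ≤ m) (hk : k ≤ m) (hjk : j ≠ k) :
    s(b, c j) ≠ s(b, c k) := by
  intro h
  rcases Sym2.eq_iff.1 h with ⟨_, h2⟩ | ⟨h1, h2⟩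
  · exact hjk (hinj j k hj hk h2)
  · exact hjk (hinj j k hj hk (h2.trans h1))

omit [Fintype V] hab hinj hca hcb in
/-- A spoke of `b` is not a rim edge. [folklore] -/
theorem spokeB_ne_rim (hcb : ∀ j, j ≤ m → c j ≠ b) {j i : ℕ} (hi : i + 1 ≤ m) : s(b, c j) ≠ s(c i, c (i + 1)) := by
  intro h
  rcases Sym2.eq_iff.1 h with ⟨h1, _⟩ | ⟨h1, _⟩
  · exact hcb i (by omega) h1.symm
  · exact hcb (i + 1) hi h1.symm

omit [Fintype V] hab hinj hca hcb in
/-- Different rim edges differ. [folklore] -/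
theorem rim_ne_rim (hinj : ∀ j k, j ≤ m → k ≤ m → c j = c k → j = k) {i k : ℕ} (hi : i + 1 ≤ m) (hk : k + 1 ≤ m) (hik : i ≠ k) :
    s(c i, c (i + 1)) ≠ s(c k, c (k + 1)) := by
  intro h
  rcases Sym2.eq_iff.1 h with ⟨h1, _⟩ | ⟨h1, h2⟩
  · exact hik (hinj i k (by omega) (by omega) h1)
  · have e1 := hinj i (k + 1) (by omega) hk h1
    have e2 := hinj (i + 1) k hi (by omega) h2
    omega

omit [Fintype V] hinj in
/-- The axis is read only by block `0`. [folklore] -/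
theorem readsAt_axis_iff {k : ℕ} (hk : k ≤ m) : ReadsAt a b c k s(a, b) ↔ k = 0 := by
  constructor
  · rintro (h | h | ⟨h, -⟩ | ⟨i, rfl, h⟩)
    · exact absurd h.symm (spokeA_ne_axis hab hcb hk)
    · exact absurd h.symm (spokeB_ne_axis hab hca hk)
    · exact h
    · exact absurd h.symm (rim_ne_axis hca hk)
  · rintro rfl; exact Or.inr (Or.inr (Or.inl ⟨rfl, rfl⟩))

omit [Fintype V] in
/-- The spoke `a c_j` is read only by block `j`. [folklore] -/
theorem readsAt_spokeA_iff {j k : ℕ} (hj : j ≤ m) (hk : k ≤ m) : ReadsAt a b c k s(a, c j) ↔ k = j := by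
  constructor
  · rintro (h | h | ⟨-, h⟩ | ⟨i, rfl, h⟩)
    · by_contra hne; exact spokeA_ne_spokeA hinj hj hk (Ne.symm hne) h
    · exact absurd h (spokeA_ne_spokeB hab hca hk)
    · exact absurd h (spokeA_ne_axis hab hcb hj)
    · exact absurd h (spokeA_ne_rim hca hk)
  · rintro rfl; exact Or.inl rfl

omit [Fintype V] in
/-- The spoke `b c_j` is read only by block `j`. [folklore] -/
theorem readsAt_spokeB_iff {j k : ℕ} (hj : j ≤ m) (hk : k ≤ m) : ReadsAt a b c k s(b, c j) ↔ k = j := by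
  constructor
  · rintro (h | h | ⟨-, h⟩ | ⟨i, rfl, h⟩)
    · exact absurd h.symm (spokeA_ne_spokeB hab hca hj)
    · by_contra hne; exact spokeB_ne_spokeB hinj hj hk (Ne.symm hne) h
    · exact absurd h (spokeB_ne_axis hab hca hj)
    · exact absurd h (spokeB_ne_rim hcb hk)
  · rintro rfl; exact Or.inr (Or.inl rfl)

omit [Fintype V] hab in
/-- The rim edge `c_i c_{i+1}` is read only by block `i+1`. [folklore] -/
theorem readsAt_rim_iff {i k : ℕ} (hi : i + 1 ≤ m) (hk : k ≤ m) : ReadsAt a b c k s(c i, c (i + 1)) ↔ k = i + 1 := by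
  constructor
  · rintro (h | h | ⟨-, h⟩ | ⟨i', rfl, h⟩)
    · exact absurd h.symm (spokeA_ne_rim hca hi)
    · exact absurd h.symm (spokeB_ne_rim hcb hi)
    · exact absurd h (rim_ne_axis hca hi)
    · by_contra hne
      exact rim_ne_rim hinj hi hk (fun h' => hne (by rw [h'])) h
  · rintro rfl; exact Or.inr (Or.inr (Or.inr ⟨i, rfl, rfl⟩))

/-! ### Affinity of the transfer expression -/

omit [Fintype V] in
/-- **`transferDF` is affine in every double-fan pair.** [folklore] -/
theorem transferDF_affine (q : ℝ) (w : Sym2 V → unitInterval) {e : Sym2 V} (he : e ∈ dfPairs a b c m) :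
    transferDF q w a b c m = (1 - ((w e : unitInterval) : ℝ)) * transferDF q (Function.update w e 0) a b c m +
      ((w e : unitInterval) : ℝ) * transferDF q (Function.update w e 1) a b c m := by
  -- it suffices to produce an affine triple at some block `j₀ ≤ m` after which `e` is not read
  suffices key : ∀ t : unitInterval, ∃ j₀, j₀ ≤ m ∧ (∀ k, j₀ < k → k ≤ m → ¬ ReadsAt a b c k e) ∧
      AffC (t : ℝ) (zDF q (Function.update w e t) a b c j₀) (zDF q (Function.update w e 0) a b c j₀)
        (zDF q (Function.update w e 1) a b c j₀) by
    obtain ⟨j₀, hj₀, hlater, h0⟩ := key (w e)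
    have h := (affC_zDF_of_le q w (w e) h0 hlater (m - j₀) (by omega)).val_eq q
    rw [show j₀ + (m - j₀) = m by omega, Function.update_eq_self] at h
    exact h
  intro t
  rcases (mem_dfPairs_iff a b c m e).1 he with rfl | ⟨j, hj, rfl | rfl⟩ | ⟨i, hi, rfl⟩
  · -- the axis, read by block 0
    refine ⟨0, Nat.zero_le _, fun k hk hkm hr => absurd ((readsAt_axis_iff hab hca hcb hkm).1 hr) (by omega), ?_⟩
    simp only [zDF, wR_update_self, Set.Icc.coe_zero, Set.Icc.coe_one, wR_update_of_ne w (spokeA_ne_axis hab hcb (Nat.zero_le _)),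
      wR_update_of_ne w (spokeB_ne_axis hab hca (Nat.zero_le _))]
    exact ((affC_conv_edgeAB _ _).conv_right _).conv_right _
  · -- the spoke `a c_j`, read by block `j`
    refine ⟨j, hj, fun k hk hkm hr => absurd ((readsAt_spokeA_iff hab hinj hca hcb hj hkm).1 hr) (by omega), ?_⟩
    rcases j with _ | j'
    · simp only [zDF, wR_update_self, Set.Icc.coe_zero, Set.Icc.coe_one, wR_update_of_ne w (spokeA_ne_spokeB hab hca hj).symm,
        wR_update_of_ne w (spokeA_ne_axis hab hcb hj).symm]
      exact affC_conv_edgeAC _ _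
    · have hbefore : ∀ v : unitInterval, zDF q (Function.update w s(a, c (j' + 1)) v) a b c j' = zDF q w a b c j' := fun v =>
        zDF_update_eq_of_not_reads q w v j' fun k hk hr => absurd ((readsAt_spokeA_iff hab hinj hca hcb hj (by omega)).1 hr) (by omega)
      simp only [zDF, hbefore, wR_update_self, Set.Icc.coe_zero, Set.Icc.coe_one, wR_update_of_ne w (spokeA_ne_spokeB hab hca hj).symm,
        wR_update_of_ne w (spokeA_ne_rim hca (j := j' + 1) hj).symm]
      exact affC_conv_edgeAC _ _
  · -- the spoke `b c_j`, read by block `j`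
    refine ⟨j, hj, fun k hk hkm hr => absurd ((readsAt_spokeB_iff hab hinj hca hcb hj hkm).1 hr) (by omega), ?_⟩
    rcases j with _ | j'
    · simp only [zDF, wR_update_self, Set.Icc.coe_zero, Set.Icc.coe_one, wR_update_of_ne w (spokeA_ne_spokeB hab hca hj),
        wR_update_of_ne w (spokeB_ne_axis hab hca hj).symm]
      exact (affC_conv_edgeBC _ _).conv_right _
    · have hbefore : ∀ v : unitInterval, zDF q (Function.update w s(b, c (j' + 1)) v) a b c j' = zDF q w a b c j' := fun v =>
        zDF_update_eq_of_not_reads q w v j' fun k hk hr => absurd ((readsAt_spokeB_iff hab hinj hca hcb hj (by omega)).1 hr) (by omega)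
      simp only [zDF, hbefore, wR_update_self, Set.Icc.coe_zero, Set.Icc.coe_one, wR_update_of_ne w (spokeA_ne_spokeB hab hca hj),
        wR_update_of_ne w (spokeB_ne_rim hcb (j := j' + 1) hj).symm]
      exact (affC_conv_edgeBC _ _).conv_right _
  · -- the rim edge `c_i c_{i+1}`, read by block `i+1`
    refine ⟨i + 1, hi, fun k hk hkm hr => absurd ((readsAt_rim_iff hinj hca hcb hi hkm).1 hr) (by omega), ?_⟩
    have hbefore : ∀ v : unitInterval, zDF q (Function.update w s(c i, c (i + 1)) v) a b c i = zDF q w a b c i := fun v =>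
      zDF_update_eq_of_not_reads q w v i fun k hk hr => absurd ((readsAt_rim_iff hinj hca hcb hi (by omega)).1 hr) (by omega)
    simp only [zDF, hbefore, wR_update_self, Set.Icc.coe_zero, Set.Icc.coe_one, wR_update_of_ne w (spokeA_ne_rim hca (j := i + 1) hi),
      wR_update_of_ne w (spokeB_ne_rim hcb (j := i + 1) hi)]
    exact ((affC_rimStep q _ _).conv_right _).conv_right _

/-- **THE TRANSFER FORMULA FOR DOUBLE FANS.**  Two distinct apices `a, b`, rim vertices `c 0, …, c m` (pairwise distinct, not apices)
exhausting `V` (`card V = m + 3`), `w` supported on the axis, the spokes and the rim edges: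
`Z_w = val_q(edgeAC · edgeBC · E_{r_{m-1}} ⋯ E_{r_0} · edgeAC · edgeBC · edgeAB · δ_0)` (weights read off `w`). [cite: Grimmett2006, §1.4 eq. (1.20) (p. 15)] -/
theorem rcPartitionFunctionW_eq_transferDF (hcard : Fintype.card V = m + 3) (q : ℝ) (w : Sym2 V → unitInterval)
    (hsupp : ∀ e, e ∉ dfPairs a b c m → w e = 0) :
    rcPartitionFunctionW w q ∅ = transferDF q w a b c m :=
  eq_of_affine_of_rigid (dfPairs a b c m) (fun u => rcPartitionFunctionW u q ∅) (fun u => transferDF q u a b c m)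
    (fun u _ e _ => rcPartitionFunctionW_affine u q e)
    (fun u _ _ he => transferDF_affine hab hinj hca hcb q u he)
    (fun u hu hr => rcPartitionFunctionW_eq_transferDF_rigid hab hinj hca hcb hcard q u hu hr) w hsupp

end Setting

end ThreeApex

end FK

end Summit.CriticalPhenomena.PercolationContinuityZ3.Theorems
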